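import Mathlib
import Literature.NumberTheory.LFunctions.Zhang2022.TypedSection15B
import HarnessLib

/-!
# Zhang (2022), §15 (15.17): "substituting `n = dl`" — the box sum of (15.11) against the main terms
# of (15.15) IS `Σ_{j≤3} ℛ_{1j}𝒮_{1j}` (a finite reindexing, kernel-checked)

Topic `Literature/NumberTheory/LFunctions/Zhang2022` (Landau–Siegel audit tree; verdict-neutral).
Y. Zhang, *Discrete mean estimates and the Landau–Siegel zero*, arXiv:2211.02515v1 (2022)
[Zhang2022LandauSiegel] — **an unrefereed manuscript under adjudication; nothing here asserts or denies
its Theorems 1–2.** §15 p. 85, tex L4226–4230: "Inserting this [(15.15)] into (15.11) and substituting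
`n = dl` we obtain (15.17) `Φ₁(p) = ℛ₁*Dpφ(D)⁻¹Σ_{j≤3}ℛ_{1j}𝒮_{1j} + o(p)` where
`𝒮_{1j} = Σ_n b(n)n⁻¹ Σ_{n=dl} λ₁(d)d^{β_j}χ(l)ℳ₁(d,l;1−β_j)`". The typed (15.11)
(`Typed.Section15A.Eq15_11`) carries the DOUBLE sum over the box `1 ≤ d, l ≤ ⌊P⌋`, the typed `𝒮_{1j}`
(`Typed.Section15B.calS1`) the sum over `1 ≤ n < ⌈P⌉` and the divisor pairs of `n`. This file PROVES
the identification of the two index sets on the support of `b` (`b(n) = 0` for `n ≥ P`, (15.2)) —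
WP15-PLAN §3.2's "check the `calS1` definitional match first" for the (15.17) assembly edge
`eq15_17_chi_of` (leaf `Eq15_17 c′ bChi`):

* `sum_box_mul_eq_sum_divisorsAntidiagonal` — for any `b, F`: if `M ≤ N + 1` and `b(n) = 0` for
  `n ≥ M`, then `Σ_{d,l ∈ [1,N]} b(dl)F(d,l) = Σ_{n ∈ [1,M)} b(n) Σ_{(d,l): dl = n} F(d,l)` (the pairs
  `(d,l)` with `dl = n < M` lie in the box; the other box terms vanish);
* `sum_box_main_eq_sum_calR1_mul_calS1` — **the (15.17) substitution**: for a coefficient sequence `b`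
  vanishing from `P` on,
  `Σ_{d,l≤⌊P⌋} b(dl)χ(l)(dl)⁻¹·λ₁(d)Σ_{j≤3}ℛ_{1j}d^{β_j}ℳ₁(d,l;1−β_j) = Σ_{j≤3} ℛ_{1j}·𝒮_{1j}(b)`
  (`ℛ_{1j} = calR1`, `ℳ₁ = calM1`, `λ₁ = lam1`, `𝒮_{1j} = calS1 c′ χ b j`), exactly in the shapes of
  `Eq15_11`'s main term (with `𝒟₁(d,l)` replaced by the main term of (15.15)) and of `Eq15_17`'s.

Theorems only; no definitions, no facts; nothing about Landau–Siegel zeros.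

## References

* Y. Zhang, arXiv:2211.02515v1 (2022), §15 (15.11) p. 83, (15.15)–(15.17) p. 85 (tex L4226–4230).
  [cite: Zhang2022LandauSiegel, §15 (15.17) p.85]
-/

noncomputable section

open Complex Finset

namespace Literature.NumberTheory.LFunctions.Zhang2022.Typed.Section15B

open Literature.NumberTheory.LFunctions.Zhang2022
open Literature.NumberTheory.LFunctions.Zhang2022.Typed.Section15A

/-! ## The generic reindexing `(d,l) ↦ n = dl` -/

/-- The divisor-pair sets of distinct numbers are disjoint. [folklore] -/
private theorem pairwiseDisjoint_divisorsAntidiagonal (S : Finset ℕ) :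
    (S : Set ℕ).PairwiseDisjoint Nat.divisorsAntidiagonal := by
  intro n _ m _ hnm
  rw [Function.onFun, Finset.disjoint_left]
  intro x hxn hxm
  have h1 := (Nat.mem_divisorsAntidiagonal.mp hxn).1
  have h2 := (Nat.mem_divisorsAntidiagonal.mp hxm).1
  exact hnm (h1.symm.trans h2)

/-- **Substituting `n = dl` in a box sum.** If `M ≤ N + 1` and `b(n) = 0` for every `n ≥ M`, then
`Σ_{d=1}^{N} Σ_{l=1}^{N} b(dl)·F(d,l) = Σ_{1≤n<M} b(n)·Σ_{(d,l), dl=n} F(d,l)`: every divisor pair of an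
`n < M` lies in the box, and the remaining box terms have `dl ≥ M` (the manuscript's "substituting
`n = dl`", §15 p. 85). [cite: Zhang2022LandauSiegel, §15 (15.17) p.85] -/
theorem sum_box_mul_eq_sum_divisorsAntidiagonal (b : ℕ → ℂ) (F : ℕ → ℕ → ℂ) {N M : ℕ}
    (hMN : M ≤ N + 1) (hb : ∀ n, M ≤ n → b n = 0) :
    ∑ d ∈ Icc 1 N, ∑ l ∈ Icc 1 N, b (d * l) * F d l =
      ∑ n ∈ Ico 1 M, b n * ∑ x ∈ n.divisorsAntidiagonal, F x.1 x.2 := by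
  classical
  -- the pair sum over the box and over the union of the divisor-pair sets
  set f : ℕ × ℕ → ℂ := fun x => b (x.1 * x.2) * F x.1 x.2 with hf
  set U : Finset (ℕ × ℕ) := (Ico 1 M).biUnion Nat.divisorsAntidiagonal with hU
  have hLHS : ∑ d ∈ Icc 1 N, ∑ l ∈ Icc 1 N, b (d * l) * F d l = ∑ x ∈ Icc 1 N ×ˢ Icc 1 N, f x := by
    rw [Finset.sum_product]
  have hRHS : ∑ n ∈ Ico 1 M, b n * ∑ x ∈ n.divisorsAntidiagonal, F x.1 x.2 = ∑ x ∈ U, f x := by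
    rw [hU, Finset.sum_biUnion (pairwiseDisjoint_divisorsAntidiagonal _)]
    refine Finset.sum_congr rfl fun n _ => ?_
    rw [Finset.mul_sum]
    refine Finset.sum_congr rfl fun x hx => ?_
    simp only [hf]
    rw [(Nat.mem_divisorsAntidiagonal.mp hx).1]
  rw [hLHS, hRHS]
  symm
  refine Finset.sum_subset ?_ ?_
  · -- `U ⊆ box`
    intro x hx
    obtain ⟨n, hn, hxn⟩ := Finset.mem_biUnion.mp hx
    obtain ⟨hprod, hn0⟩ := Nat.mem_divisorsAntidiagonal.mp hxn
    have hnM : n < M := (Finset.mem_Ico.mp hn).2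
    have hx1 : x.1 ∣ n := ⟨x.2, hprod.symm⟩
    have hx2 : x.2 ∣ n := ⟨x.1, by rw [mul_comm]; exact hprod.symm⟩
    have hnpos : 0 < n := Nat.pos_of_ne_zero hn0
    have h1le : x.1 ≤ n := Nat.le_of_dvd hnpos hx1
    have h2le : x.2 ≤ n := Nat.le_of_dvd hnpos hx2
    have h1pos : 0 < x.1 := Nat.pos_of_ne_zero fun h => hn0 (by rw [← hprod, h, zero_mul])
    have h2pos : 0 < x.2 := Nat.pos_of_ne_zero fun h => hn0 (by rw [← hprod, h, mul_zero])
    refine Finset.mem_product.mpr ⟨Finset.mem_Icc.mpr ⟨h1pos, by omega⟩,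
      Finset.mem_Icc.mpr ⟨h2pos, by omega⟩⟩
  · -- outside `U` the terms vanish
    intro x hx hxU
    obtain ⟨h1, h2⟩ := Finset.mem_product.mp hx
    have h1pos : 1 ≤ x.1 := (Finset.mem_Icc.mp h1).1
    have h2pos : 1 ≤ x.2 := (Finset.mem_Icc.mp h2).1
    have hge : M ≤ x.1 * x.2 := by
      by_contra hlt
      push Not at hlt
      refine hxU (Finset.mem_biUnion.mpr ⟨x.1 * x.2, ?_, ?_⟩)
      · exact Finset.mem_Ico.mpr ⟨Nat.one_le_iff_ne_zero.mpr (Nat.mul_ne_zero (by omega) (by omega)), hlt⟩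
      · exact Nat.mem_divisorsAntidiagonal.mpr ⟨rfl, Nat.mul_ne_zero (by omega) (by omega)⟩
    rw [hf]
    simp only [hb _ hge, zero_mul]

/-! ## The (15.17) substitution -/

/-- **"Substituting `n = dl`"** (§15 p. 85, tex L4226): for a coefficient sequence `b` with `b(n) = 0`
for `n ≥ P` (as (15.2) gives for the printed `b` and for `χ·b`, `bLit_eq_zero_of_bigP_le`,
`bChi_eq_zero_of_bigP_le`), the box main term of (15.11) with `𝒟₁(d,l)` replaced by the main term
`λ₁(d)Σ_{j≤3}ℛ_{1j}d^{β_j}ℳ₁(d,l;1−β_j)` of (15.15) equals `Σ_{j≤3} ℛ_{1j}𝒮_{1j}(b)`.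
[cite: Zhang2022LandauSiegel, §15 (15.17) p.85] -/
theorem sum_box_main_eq_sum_calR1_mul_calS1 (c' : ℝ) {D : ℕ} [NeZero D]
    (χ : DirichletCharacter ℂ D) (b : ℕ → ℂ) (hb : ∀ n : ℕ, Skeleton.bigP D ≤ n → b n = 0) :
    ∑ d ∈ Icc 1 ⌊Skeleton.bigP D⌋₊, ∑ l ∈ Icc 1 ⌊Skeleton.bigP D⌋₊,
        b (d * l) * χ (l : ZMod D) / ((d : ℂ) * l) *
          (lam1 c' χ d 1 * ∑ j ∈ ({1, 2, 3} : Finset ℕ),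
            calR1 c' χ j * (d : ℂ) ^ Skeleton.betaJ c' D j *
              calM1 c' χ d l (1 - Skeleton.betaJ c' D j)) =
      ∑ j ∈ ({1, 2, 3} : Finset ℕ), calR1 c' χ j * calS1 c' χ b j := by
  classical
  set P := Skeleton.bigP D with hP
  have hMN : ⌈P⌉₊ ≤ ⌊P⌋₊ + 1 := Nat.ceil_le_floor_add_one P
  have hbM : ∀ n : ℕ, ⌈P⌉₊ ≤ n → b n = 0 := fun n hn =>
    hb n ((Nat.le_ceil P).trans (by exact_mod_cast hn))
  -- move the `j`-sum outside
  have hswap : ∑ d ∈ Icc 1 ⌊P⌋₊, ∑ l ∈ Icc 1 ⌊P⌋₊,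
        b (d * l) * χ (l : ZMod D) / ((d : ℂ) * l) *
          (lam1 c' χ d 1 * ∑ j ∈ ({1, 2, 3} : Finset ℕ),
            calR1 c' χ j * (d : ℂ) ^ Skeleton.betaJ c' D j *
              calM1 c' χ d l (1 - Skeleton.betaJ c' D j)) =
      ∑ j ∈ ({1, 2, 3} : Finset ℕ), calR1 c' χ j *
        ∑ d ∈ Icc 1 ⌊P⌋₊, ∑ l ∈ Icc 1 ⌊P⌋₊,
          b (d * l) * (χ (l : ZMod D) / ((d : ℂ) * l) * lam1 c' χ d 1 *
            (d : ℂ) ^ Skeleton.betaJ c' D j * calM1 c' χ d l (1 - Skeleton.betaJ c' D j)) := by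
    -- expand the inner `j`-sums on the left
    have hL : ∑ d ∈ Icc 1 ⌊P⌋₊, ∑ l ∈ Icc 1 ⌊P⌋₊,
        b (d * l) * χ (l : ZMod D) / ((d : ℂ) * l) *
          (lam1 c' χ d 1 * ∑ j ∈ ({1, 2, 3} : Finset ℕ),
            calR1 c' χ j * (d : ℂ) ^ Skeleton.betaJ c' D j *
              calM1 c' χ d l (1 - Skeleton.betaJ c' D j)) =
        ∑ d ∈ Icc 1 ⌊P⌋₊, ∑ l ∈ Icc 1 ⌊P⌋₊, ∑ j ∈ ({1, 2, 3} : Finset ℕ), calR1 c' χ j *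
          (b (d * l) * (χ (l : ZMod D) / ((d : ℂ) * l) * lam1 c' χ d 1 *
            (d : ℂ) ^ Skeleton.betaJ c' D j * calM1 c' χ d l (1 - Skeleton.betaJ c' D j))) := by
      refine Finset.sum_congr rfl fun d _ => Finset.sum_congr rfl fun l _ => ?_
      rw [Finset.mul_sum, Finset.mul_sum]
      refine Finset.sum_congr rfl fun j _ => ?_
      ring
    -- expand the right side likewise
    have hR : ∑ j ∈ ({1, 2, 3} : Finset ℕ), calR1 c' χ j *
        ∑ d ∈ Icc 1 ⌊P⌋₊, ∑ l ∈ Icc 1 ⌊P⌋₊,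
          b (d * l) * (χ (l : ZMod D) / ((d : ℂ) * l) * lam1 c' χ d 1 *
            (d : ℂ) ^ Skeleton.betaJ c' D j * calM1 c' χ d l (1 - Skeleton.betaJ c' D j)) =
        ∑ j ∈ ({1, 2, 3} : Finset ℕ), ∑ d ∈ Icc 1 ⌊P⌋₊, ∑ l ∈ Icc 1 ⌊P⌋₊, calR1 c' χ j *
          (b (d * l) * (χ (l : ZMod D) / ((d : ℂ) * l) * lam1 c' χ d 1 *
            (d : ℂ) ^ Skeleton.betaJ c' D j * calM1 c' χ d l (1 - Skeleton.betaJ c' D j))) := by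
      refine Finset.sum_congr rfl fun j _ => ?_
      rw [Finset.mul_sum]
      refine Finset.sum_congr rfl fun d _ => ?_
      rw [Finset.mul_sum]
    rw [hL, hR]
    exact (Finset.sum_congr rfl fun d _ => Finset.sum_comm).trans Finset.sum_comm
  rw [hswap]
  refine Finset.sum_congr rfl fun j _ => ?_
  congr 1
  rw [sum_box_mul_eq_sum_divisorsAntidiagonal b _ hMN hbM, calS1]
  refine Finset.sum_congr rfl fun n _ => ?_
  rw [div_eq_mul_inv (b n), mul_assoc, Finset.mul_sum (n.divisorsAntidiagonal) _ ((n : ℂ)⁻¹)]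
  congr 1
  refine Finset.sum_congr rfl fun x hx => ?_
  obtain ⟨hprod, -⟩ := Nat.mem_divisorsAntidiagonal.mp hx
  have hcast : ((x.1 : ℂ) * x.2) = (n : ℂ) := by rw [← Nat.cast_mul, hprod]
  rw [← hcast]
  ring

end Literature.NumberTheory.LFunctions.Zhang2022.Typed.Section15B

end
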